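import Mathlib
import HarnessLib
import Literature.LinearAlgebra.Matrix.PerronSymmetric

/-!
# One-sided Haynsworth: the Schur complement bounds the quadratic form from below (certified inertia by pinning)

Topic `Literature/Analysis/OperatorTheory`; proofs-layer file. In a validated eigenvalue COUNT for a large sparse
symmetric pencil `K − sM` (finite elements), one cannot afford a certified sparse `LDLᵀ`. The standard device
(Haynsworth inertia additivity [cite: Haynsworth1968, Thm 1]; used here one-sidedly) splits the degrees of freedom into
a "free" block `f` on which `A_ff ≻ 0` is certified (a floating Cholesky attempt plus an a-priori rounding criterion) and a
small "pinned" block `c`; completing the square,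
`(x ⊕ y)ᵀ [[A_ff, B],[Bᵀ, D]] (x ⊕ y) = (x + A_ff⁻¹B y)ᵀ A_ff (x + A_ff⁻¹B y) + yᵀ (D − Bᵀ A_ff⁻¹ B) y ≥ yᵀ S y`
with the SMALL dense Schur complement `S`, whose inertia is certified directly. Consequently, if `yᵀ S y ≥ 0` whenever
`k` linear conditions on `y` vanish (e.g. `y` Euclidean-orthogonal to the `k` negative eigenvectors of `S`), then the full
form is nonnegative under the same `k` conditions — which is exactly the discrete-coercivity hypothesis `hcoer` of
`liu_count_bound` (`ProjectionLowerBound.lean`) with `m = k`. Pure matrix algebra over `ℝ`; Mathlib's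
`Matrix.schur_complement_eq₁₁` does the work. [cite: Haynsworth1968, Thm 1] [folklore]
-/

namespace Literature.Analysis.OperatorTheory

open Matrix
open scoped Matrix

variable {m n : Type*} [Fintype m] [Fintype n] [DecidableEq m]

/-- **One-sided Haynsworth.** For a real block matrix `[[A, B],[Bᵀ, D]]` with `A` positive semidefinite and
invertible, the quadratic form dominates the form of the Schur complement `D − Bᵀ A⁻¹ B` in the second block
variable. [cite: Haynsworth1968, Thm 1] -/
theorem schur_dotProduct_le_fromBlocks (A : Matrix m m ℝ) (B : Matrix m n ℝ) (D : Matrix n n ℝ)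
    (hA : A.PosSemidef) [Invertible A] (x : m → ℝ) (y : n → ℝ) :
    y ⬝ᵥ ((D - Bᴴ * A⁻¹ * B) *ᵥ y) ≤ (x ⊕ᵥ y) ⬝ᵥ (fromBlocks A B Bᴴ D *ᵥ (x ⊕ᵥ y)) := by
  have h1 : (x ⊕ᵥ y) ⬝ᵥ (fromBlocks A B Bᴴ D *ᵥ (x ⊕ᵥ y)) =
      (star (x ⊕ᵥ y)) ᵥ* (fromBlocks A B Bᴴ D) ⬝ᵥ (x ⊕ᵥ y) := by
    rw [dotProduct_mulVec, star_trivial]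
  have h2 : y ⬝ᵥ ((D - Bᴴ * A⁻¹ * B) *ᵥ y) = (star y) ᵥ* (D - Bᴴ * A⁻¹ * B) ⬝ᵥ y := by
    rw [dotProduct_mulVec, star_trivial]
  rw [h1, h2, schur_complement_eq₁₁ B D x y hA.1]
  have h3 : 0 ≤ (star (x + (A⁻¹ * B) *ᵥ y)) ᵥ* A ⬝ᵥ (x + (A⁻¹ * B) *ᵥ y) := by
    rw [← dotProduct_mulVec]
    exact (posSemidef_iff_dotProduct_mulVec.mp hA).2 _
  linarith

/-- **Certified count by pinning.** If the Schur complement's form is nonnegative on the common kernel of `k` linear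
functionals `ℓ j` of the pinned variable `y` (for instance: `y` orthogonal to the negative eigenvectors of a certified
eigendecomposition of the small dense Schur complement, `k` = their number), then the full quadratic form is
nonnegative on the common kernel of the same functionals (read on the `y`-block). With `fromBlocks A B Bᴴ D = K − sM`
in a basis of the trial space this is hypothesis `hcoer` of `liu_count_bound` with `m = k`, hence at most `k` exact
eigenvalues lie below `s/(1 + C² s)`. [cite: Haynsworth1968, Thm 1] [folklore] -/
theorem fromBlocks_dotProduct_nonneg_of_schur {k : ℕ} (A : Matrix m m ℝ) (B : Matrix m n ℝ) (D : Matrix n n ℝ)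
    (hA : A.PosSemidef) [Invertible A] (ℓ : Fin k → (n → ℝ) →ₗ[ℝ] ℝ)
    (hS : ∀ y : n → ℝ, (∀ j, ℓ j y = 0) → 0 ≤ y ⬝ᵥ ((D - Bᴴ * A⁻¹ * B) *ᵥ y))
    (x : m → ℝ) (y : n → ℝ) (hy : ∀ j, ℓ j y = 0) :
    0 ≤ (x ⊕ᵥ y) ⬝ᵥ (fromBlocks A B Bᴴ D *ᵥ (x ⊕ᵥ y)) :=
  le_trans (hS y hy) (schur_dotProduct_le_fromBlocks A B D hA x y)

/-- The same with a certified POSITIVE DEFINITE free block (the form in which the certificate delivers it: a verified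
Cholesky of `A_ff − σI`, `σ > 0`); invertibility is then automatic. [cite: Haynsworth1968, Thm 1] [folklore] -/
theorem fromBlocks_dotProduct_nonneg_of_schur_posDef {k : ℕ} (A : Matrix m m ℝ) (B : Matrix m n ℝ)
    (D : Matrix n n ℝ) (hA : A.PosDef) (ℓ : Fin k → (n → ℝ) →ₗ[ℝ] ℝ)
    (hS : letI := hA.isUnit.invertible
      ∀ y : n → ℝ, (∀ j, ℓ j y = 0) → 0 ≤ y ⬝ᵥ ((D - Bᴴ * A⁻¹ * B) *ᵥ y))
    (x : m → ℝ) (y : n → ℝ) (hy : ∀ j, ℓ j y = 0) :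
    0 ≤ (x ⊕ᵥ y) ⬝ᵥ (fromBlocks A B Bᴴ D *ᵥ (x ⊕ᵥ y)) := by
  letI := hA.isUnit.invertible
  exact fromBlocks_dotProduct_nonneg_of_schur A B D hA.posSemidef ℓ hS x y hy

end Literature.Analysis.OperatorTheory

namespace Literature.Analysis.OperatorTheory

open Matrix
open scoped Matrix

variable {n : Type*} [Fintype n]

/-- Quadratic form of a rank-one matrix: `yᵀ (a bᵀ) y = (y·a)(b·y)`. [folklore] -/
theorem dotProduct_vecMulVec_mulVec (a b y : n → ℝ) :
    y ⬝ᵥ (vecMulVec a b *ᵥ y) = (y ⬝ᵥ a) * (b ⬝ᵥ y) := by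
  have h1 : vecMulVec a b *ᵥ y = (b ⬝ᵥ y) • a := by
    ext i
    simp only [mulVec, dotProduct, vecMulVec_apply, Pi.smul_apply, smul_eq_mul, Finset.sum_mul]
    exact Finset.sum_congr rfl fun l _ => by ring
  rw [h1, dotProduct_smul, smul_eq_mul, mul_comm]

/-- **Deflation certificate for the small dense block.** If `S + P` is positive semidefinite for some matrix `P` whose
quadratic form vanishes on the common kernel of the test functionals (e.g. `P = Σ_j t_j q_j q_jᵀ` built from FLOAT
approximate negative eigenvectors `q_j` — no exact eigenvectors are needed — with `S + P ≻ 0` verified by an interval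
Cholesky), then `yᵀ S y ≥ 0` whenever `q_j · y = 0` for all `j`: hypothesis `hS` of
`fromBlocks_dotProduct_nonneg_of_schur` with `k` = the number of deflation vectors. [folklore] -/
theorem dotProduct_mulVec_nonneg_of_posSemidef_add {k : ℕ} (S P : Matrix n n ℝ) (q : Fin k → n → ℝ)
    (hSP : (S + P).PosSemidef)
    (hP : ∀ y : n → ℝ, (∀ j, q j ⬝ᵥ y = 0) → y ⬝ᵥ (P *ᵥ y) = 0)
    (y : n → ℝ) (hy : ∀ j, q j ⬝ᵥ y = 0) : 0 ≤ y ⬝ᵥ (S *ᵥ y) := by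
  have h := (posSemidef_iff_dotProduct_mulVec.mp hSP).2 y
  rw [star_trivial, add_mulVec, dotProduct_add, hP y hy, add_zero] at h
  exact h

/-- The rank-`k` deflation `P = Σ_j t_j q_j q_jᵀ` has vanishing form on `{y : q_j · y = 0 ∀ j}`. [folklore] -/
theorem dotProduct_sum_vecMulVec_mulVec_eq_zero {k : ℕ} (t : Fin k → ℝ) (q : Fin k → n → ℝ) (y : n → ℝ)
    (hy : ∀ j, q j ⬝ᵥ y = 0) :
    y ⬝ᵥ ((∑ j, t j • vecMulVec (q j) (q j)) *ᵥ y) = 0 := by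
  rw [Matrix.sum_mulVec, dotProduct_sum]
  refine Finset.sum_eq_zero fun j _ => ?_
  rw [Matrix.smul_mulVec, dotProduct_smul, dotProduct_vecMulVec_mulVec, hy j, mul_zero, smul_zero]

end Literature.Analysis.OperatorTheory

namespace Literature.Analysis.OperatorTheory

open Matrix
open scoped Matrix

variable {n : Type*} [Fintype n]

/-! ### Constrained positivity from an inertia COUNT (exact eigenvectors as the constraint functionals)

In Liu's projection counting bound (`ProjectionLowerBound.liu_card_le_bracket`) the `N` constraint functionals are free;
taking them to be the EXACT eigenvectors of the symmetric matrix `H = K − sM` belonging to its negative eigenvalues, the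
discrete coercivity hypothesis (`hcoer_of_matrices.hpos`) needs only the INERTIA COUNT `#{i : λ_i(H) < 0} ≤ N`, which is
what a validated `LDLᵀ` / Haynsworth pin-split certificate delivers — no approximate eigenvectors enter the statement.
-/

/-- **Constrained positivity from inertia.** If a real symmetric matrix `H` has at most `N` negative eigenvalues
(counted in Mathlib's spectral list), then there are `N` vectors `q_j` such that `yᵀHy ≥ 0` whenever `q_j ⬝ y = 0` for
all `j` — namely the rows of `Uᵀ` for the negative eigenvalues (padded with zeros), by the spectral decomposition
`yᵀHy = ∑ λ_i (Uᵀy)_i²`. [cite: Haynsworth1968, Thm 1 (inertia); folklore consequence of the spectral theorem] -/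
theorem exists_constraints_nonneg_of_inertia_le [DecidableEq n] {H : Matrix n n ℝ} (hH : H.IsHermitian) {N : ℕ}
    (hN : Fintype.card {i : n // hH.eigenvalues i < 0} ≤ N) :
    ∃ q : Fin N → n → ℝ, ∀ y : n → ℝ, (∀ j, q j ⬝ᵥ y = 0) → 0 ≤ y ⬝ᵥ (H *ᵥ y) := by
  classical
  obtain ⟨e⟩ : Nonempty ({i : n // hH.eigenvalues i < 0} ↪ Fin N) :=
    Function.Embedding.nonempty_iff_card_le.2 (by simpa using hN)
  -- row `i` of `Uᵀ`
  set U := Literature.LinearAlgebra.Matrix.eigU hH with hU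
  refine ⟨fun j => ∑ i : {i : n // hH.eigenvalues i < 0}, if e i = j then (fun k => (star U) i.1 k) else 0, ?_⟩
  intro y hy
  -- the constraint kills every negative spectral coordinate
  have hcoord : ∀ i : n, hH.eigenvalues i < 0 → (star U *ᵥ y) i = 0 := by
    intro i hi
    have h := hy (e ⟨i, hi⟩)
    have hq : (∑ i' : {i : n // hH.eigenvalues i < 0}, if e i' = e ⟨i, hi⟩ then (fun k => (star U) i'.1 k) else 0)
        = fun k => (star U) i k := by
      rw [Finset.sum_eq_single ⟨i, hi⟩]
      · simp
      · intro b _ hb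
        have : e b ≠ e ⟨i, hi⟩ := fun h' => hb (e.injective h')
        simp [this]
      · intro h'; exact absurd (Finset.mem_univ _) h'
    have h' : (fun k => (star U) i k) ⬝ᵥ y = 0 := by
      have h2 := h
      simp only [] at h2
      rw [hq] at h2
      exact h2
    simpa [Matrix.mulVec, dotProduct] using h'
  rw [Literature.LinearAlgebra.Matrix.dotProduct_mulVec_eq_sum hH y]
  refine Finset.sum_nonneg fun i _ => ?_
  by_cases hi : hH.eigenvalues i < 0
  · rw [← hU, hcoord i hi]; simp
  · exact mul_nonneg (le_of_not_gt hi) (sq_nonneg _)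

/-- Matrix form used by the certificate: inertia count `≤ N` ⇒ the hypothesis `hpos` of
`ProjectionLowerBound.hcoer_of_matrices` for SOME `N` constraint vectors. [folklore] -/
theorem exists_hpos_of_inertia_le [DecidableEq n] (K M : Matrix n n ℝ) (s : ℝ) (hH : (K - s • M).IsHermitian) {N : ℕ}
    (hN : Fintype.card {i : n // hH.eigenvalues i < 0} ≤ N) :
    ∃ q : Fin N → n → ℝ, ∀ y : n → ℝ, (∀ j, q j ⬝ᵥ y = 0) → 0 ≤ y ⬝ᵥ ((K - s • M) *ᵥ y) :=
  exists_constraints_nonneg_of_inertia_le hH hN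

end Literature.Analysis.OperatorTheory
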